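import Literature.MathematicalPhysics.QuantumFieldTheory.Balaban1983to89.B16Prop1IVInverseC
import Literature.MathematicalPhysics.QuantumFieldTheory.Balaban1983to89.B11Prop6Scheme
import Literature.Analysis.Complex.HolomorphicBanach

/-!
# `Balaban1983to89.B16Prop1IVFromProp4` — [Balaban1989LargeFieldII] p. 359: *«Using Proposition 4 [15] and the fixed
point theorem for contractive mappings, we can easily prove that the above equation has exactly one solution»* — the
«Proposition 4 [15]» hypotheses of the complex-model Proposition 1 [IV] / (1.40)–(1.41) theorems SUPPLIED BY NAME from
[15]'s Proposition 4 in the tree's Fréchet form (`…B11Prop6Scheme.Prop4Hyp`)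

T. Bałaban, *Large field renormalization. II. Localization, exponentiation, and bounds for the 𝐑 operation*, Commun.
Math. Phys. **122** (1989) 355–392 [Balaban1989LargeFieldII] (cell paper B16; PDF held
`paper:balaban1989-cmp122-large-field-ii`, journal page = PDF page + 354; p. 359 = PDF 5, p. 367 = PDF 13); [15] =
T. Bałaban, *The variational problem and background fields in renormalization group method for lattice gauge
theories*, Commun. Math. Phys. **102** (1985) 277–309 [Balaban1985Variational], Proposition 4 (97)–(98) pp. 292–293.

statement-level skeleton of published theorems with citation tags; proofs where landed; nothing here is a claim about
the Yang–Mills mass gap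

CITATION HEADER / WHAT IS REPRODUCED.  Mega-formalization `lit-balaban`, HOME `run/shared/lean/pub/lit-balaban/`;
reader/typer **r13 gen 17** (B16 display-level owner; rows `lit-balaban-r13/ROWS-B16.md`).  SKELETON rows
**B16.Prop1[IV]** (the p. 359 proof of Proposition 1 [IV]) and **B16.Eq1.41** ((1.40)/(1.41) p. 367), cross-paper
edges B16.Prop1[IV] → B11.Prop4 and B16.Eq1.41 → B11.Prop4 of `lit-balaban-r13/DEPGRAPH-r13.json`.
p. 359, verbatim: *«(1.13) Using Proposition 4 [15] and the fixed point theorem for contractive mappings, we can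
easily prove that the above equation has exactly one solution, which has a bound equal to twice a bound of the
right-hand side of the equation … The above equations, bounds and statements are valid for 𝔤ᶜ-valued fields, hence
the existence of the analytic extension follows immediately, and Proposition 1 [IV] is proved.»*  p. 367: *«We can
prove again that Eq. (1.40) has exactly one solution B′_Λ(B̃′), which is an analytic function of the 𝔤ᶜ-valued small
field B̃′, satisfying the bound (1.41)»*.  [15] Proposition 4, p. 292: *«The functional derivative of V(A′) is an
analytic function on this space, and satisfies the estimate |(δ/δA′)V(A′)| ≦ C₄|A′|² … (98)»*.

STATE OF THE TREE BEFORE THIS FILE.  The complex-model theorems of these rows (`…B16Prop1IVAnalytic`,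
`…B16Ineq141Solution`; since `…B16Prop1IVInverseC` (r13 gen 17) with the inverse of `P₀H*Δ₁HP₀` DERIVED from
(1.9)) take «Proposition 4 [15]» as three LOCATED hypotheses on `dV = (δ/δA)V : F → F`: `dV 0 = 0`, a Lipschitz
constant `ℓ` on a ball `‖u‖ ≦ ρ`, and `ℂ`-analyticity on `‖u‖ < ρ` (§2f.3 owner reading of B16.Prop1[IV], HOME/INBOX
2026-08-22T02:28Z: prerequisite B11.Prop4 case (a), binders `hdV0`/`hdV`/`hsmall`).  The B11 block (r08) carries
Proposition 4 in exactly the form its own Prop. 6 contraction scheme consumes — `B11Prop6Scheme.Prop4Hyp W C₄ a₃`: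
the quadratic bound `‖W Y‖ ≦ C₄‖Y‖²` on `‖Y‖ < a₃` and Fréchet `DifferentiableOn ℂ W {‖Y‖ < a₃}` —, INHABITED for the
concrete object `W80 = (δ/δA′)V` of (80) on the (115) torus carriers (`B11Eq98CurrentSlot.prop4Hyp_W80`, r08 g14),
together with the Cauchy-formula Lipschitz step (119)–(120) (`B11Prop6Scheme.lipschitz_120`).
THIS FILE knits the two: §1 derives the three located hypotheses from `Prop4Hyp dV C₄ a₃` — **`dV_zero_of_prop4Hyp`**
(`dV 0 = 0` from (98) at `0`), **`lipschitz_of_prop4Hyp`** (`dV` is `4C₄(ρ + a)`-Lipschitz on `‖u‖ ≦ ρ` whenever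
`2(ρ + a) ≦ a₃`, `a > 0` — `lipschitz_120` BY NAME with `𝒢 = 1`, `Λ = 0`, `J = 0`, `𝔄 = 0`: [15]'s own (119)–(120)
Cauchy step), **`analyticAt_of_prop4Hyp`** (Fréchet-differentiable on the open ball ⇒ analytic there, the tree's
[Chae1985] Thm 14.13 `HolomorphicBanach.analyticAt_of_differentiableOn`); §2 **`prop1IV_of_ineq19_prop4`** =
Proposition 1 [IV] in the complex model from (1.9) (`hpos`) AND Proposition 4 [15] (`Prop4Hyp`) BY NAME: the inverse
with the printed bound, and the critical configuration `B′(J)` analytic in the current `J`, solving (1.13), with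
*«a bound equal to twice a bound of the right-hand side»*; §3 **`exists_analytic_solution140_of_ineq19_prop4`**,
**`exactlyOne141_of_ineq19_prop4`** = the same for (1.40)/(1.41) ((1.41) AS TYPED).  The remaining hypotheses are
operator data and bounds (`P₀` idempotent symmetric, `H*` the adjoint of `H`, `‖H‖ ≦ h₁`, `‖H*‖ ≦ hst`,
`‖Δ₁Hx‖ ≦ b‖x‖`), the printed-shape room/smallness conditions (now with `ℓ = 4C₄(ρ + a)`: small fields ⇒ small `ℓ`,
[15] p. 292 «V is of third order»), and the bookkeeping `c = γ₀/(2d(100M)⁵)`, `hst·b ≦ B₃²` for (1.41).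
Theorems only; no `sorry`; no new definition, no `… : Prop` fact.
HONEST SCOPE.  `Prop4Hyp` is r08's HYPOTHESIS STRUCTURE for [15] Prop. 4 (row B11.Prop4 typed; inhabited per lattice
by `prop4Hyp_W80`, print's lattice-uniform constants not certified — see r08's owner reading); here it is consumed for an
abstract `dV : F → F` on a complete complex inner-product space `F` (finite-dimensional in print); the identification
of `F`/`dV` with the (115) carriers / `W80` is NOT made in this file (different carriers: the cell's «schematic
typing» divergence); (1.9) enters as `hpos`; operators fixed data; analyticity in `J` resp. `B̃′` only.  NOT summit
progress.
-/

noncomputable section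

namespace Literature.MathematicalPhysics.QuantumFieldTheory.Balaban1983to89.B16Prop1IVFromProp4

open Metric
open scoped InnerProductSpace
open Literature.MathematicalPhysics.QuantumFieldTheory.Balaban1983to89
open Literature.MathematicalPhysics.QuantumFieldTheory.Balaban1983to89.B11Prop6Scheme (Prop4Hyp mapT lipschitz_120)

/-! ## §1. The three located «Proposition 4 [15]» hypotheses from `Prop4Hyp` -/

section FromProp4

variable {F : Type*} [NormedAddCommGroup F] [NormedSpace ℂ F]

/-- (98) at the zero configuration: `‖(δ/δA)V(0)‖ ≦ C₄·0²`, so `dV 0 = 0` ([15] p. 292 «V is of third order»; the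
hypothesis `hdV0` of the (1.13)/(1.40) contraction theorems). [cite: Balaban1985Variational, Prop. 4 (98) p.293]
[cite: Balaban1989LargeFieldII, p.359 («Using Proposition 4 [15]»)] -/
theorem dV_zero_of_prop4Hyp {dV : F → F} {C₄ a₃ : ℝ} (hW : Prop4Hyp dV C₄ a₃) (ha₃ : 0 < a₃) : dV 0 = 0 := by
  have h := hW.quad 0 (by rwa [norm_zero])
  rw [norm_zero] at h
  have h' : ‖dV 0‖ ≤ 0 := by simpa using h
  exact norm_le_zero_iff.mp h'

/-- **The Lipschitz constant of `(δ/δA)V` on a ball, from Proposition 4 [15]** — [15]'s own Cauchy-formula step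
(119)–(120) p. 295 (`B11Prop6Scheme.lipschitz_120` BY NAME, with `𝒢 = 1`, `Λ = 0`, `J = 0`, `𝔄 = 0`): if
`Prop4Hyp dV C₄ a₃`, then on the ball `‖u‖ ≦ ρ` the map `dV` is Lipschitz with constant `4C₄(ρ + a)` for every `a > 0`
with `2(ρ + a) ≦ a₃` (the hypothesis `hdV` of the (1.13)/(1.40) contraction theorems, with `ℓ` small for small fields).
[cite: Balaban1985Variational, (119)-(120) p.295; Prop. 4 (98) p.293] [cite: Balaban1989LargeFieldII, p.359] -/
theorem lipschitz_of_prop4Hyp {dV : F → F} {C₄ a₃ ρ a : ℝ} (hW : Prop4Hyp dV C₄ a₃) (hC₄ : 0 ≤ C₄) (ha : 0 < a)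
    (hρ : 0 ≤ ρ) (hdom : 2 * (ρ + a) ≤ a₃) :
    ∀ u v : F, ‖u‖ ≤ ρ → ‖v‖ ≤ ρ → ‖dV u - dV v‖ ≤ 4 * C₄ * (ρ + a) * ‖u - v‖ := by
  intro u v hu hv
  have h𝒢 : ∀ f : F, ‖(ContinuousLinearMap.id ℂ F) f‖ ≤ 1 * ‖f‖ := fun f => by simp
  have hΛ : ∀ Y : F, ‖(0 : F →L[ℂ] F) Y‖ ≤ 0 * ‖Y‖ := fun Y => by simp
  have h𝔄 : ‖(0 : F)‖ < a := by rwa [norm_zero]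
  have h := lipschitz_120 (J := (0 : F)) h𝒢 hΛ hW.quadAnalytic zero_le_one hC₄ h𝔄 hρ hdom hu hv
  have e : mapT (ContinuousLinearMap.id ℂ F) 0 dV 0 0 u - mapT (ContinuousLinearMap.id ℂ F) 0 dV 0 0 v =
      -(dV u - dV v) := by
    simp only [mapT, add_zero, map_zero, neg_zero, zero_apply, ContinuousLinearMap.coe_id', id_eq]
    abel
  rw [e, norm_neg] at h
  calc ‖dV u - dV v‖ ≤ (0 + 4 * 1 * C₄ * (ρ + a)) * ‖u - v‖ := h
    _ = 4 * C₄ * (ρ + a) * ‖u - v‖ := by ring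

/-- **Analyticity of `(δ/δA)V` from Proposition 4 [15]** (*«The functional derivative of V(A′) is an analytic
function on this space»*, p. 292): Fréchet-differentiable on the open ball `‖u‖ < a₃` ⇒ analytic at each of its
points (the tree's [Chae1985] Thm 14.13, `HolomorphicBanach.analyticAt_of_differentiableOn`; `F` complete) — the
hypothesis `hA` of the analytic-extension theorems. [cite: Balaban1985Variational, Prop. 4 p.292]
[cite: Balaban1989LargeFieldII, p.359 («valid for 𝔤ᶜ-valued fields, hence the existence of the analytic extension
follows immediately»)] -/
theorem analyticAt_of_prop4Hyp [CompleteSpace F] {dV : F → F} {C₄ a₃ : ℝ} (hW : Prop4Hyp dV C₄ a₃) {u : F}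
    (hu : ‖u‖ < a₃) : AnalyticAt ℂ dV u :=
  Literature.Analysis.Complex.HolomorphicBanach.analyticAt_of_differentiableOn hW.differentiableOn
    (isOpen_lt continuous_norm continuous_const) hu

end FromProp4

/-! ## §2. Proposition 1 [IV] in the complex model from (1.9) and Proposition 4 [15] BY NAME -/

section Assembly

variable {E F : Type*} [NormedAddCommGroup E] [InnerProductSpace ℂ E] [FiniteDimensional ℂ E]
  [NormedAddCommGroup F] [InnerProductSpace ℂ F] [CompleteSpace F]

/-- **Proposition 1 [IV], p. 359, complex model — *«By the inequality (1.9) … Using Proposition 4 [15] and the fixed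
point theorem for contractive mappings …»* with BOTH printed inputs supplied by name-shape**: (1.9) as the positivity
`hpos : c‖B′‖² ≦ re ⟨HB′, Δ₁HB′⟩` on the gauge subspace (`…B16Prop1IVInverseC.exists_inverse_of_pos`), Proposition 4
[15] as r08's `B11Prop6Scheme.Prop4Hyp dV C₄ a₃` (§1).  Remaining hypotheses: `P₀` idempotent symmetric, `H* = Hst`
the adjoint of `H`, `‖H‖ ≦ h₁`, `‖H*‖ ≦ hst`, a radius `ρ > 0` and `a > 0` with `2(ρ + a) ≦ a₃`, the room `h₁·3r ≦ ρ`
and the smallness `c⁻¹hst·(4C₄(ρ + a))·h₁ ≦ ½` (small fields).  Conclusion: a bounded inverse `Kinv` of `P₀H*Δ₁HP₀`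
on the gauge subspace with `‖Kinv x‖ ≦ c⁻¹‖P₀x‖` (*«bounded by γ₀⁻¹2d(100M)⁵»*) and `‖Kinv P₀ H* z‖ ≦ c⁻¹hst‖z‖`, and a
critical configuration `B′(J)`, `ℂ`-analytic at every current `J` with `‖Kinv P₀ H* J‖ < r`, solving (1.13)
`B′ + Kinv P₀ H* dV(H B′) = −Kinv P₀ H* J` with `‖B′(J)‖ ≦ 2‖Kinv P₀ H* J‖` (*«exactly one solution, which has a bound
equal to twice a bound of the right-hand side … hence the existence of the analytic extension follows immediately, and
Proposition 1 [IV] is proved»*). [cite: Balaban1989LargeFieldII, p.359 (proof of Proposition 1 [IV]); (1.9) p.358]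
[cite: Balaban1985Variational, Prop. 4 (97)-(98) pp.292-293] -/
theorem prop1IV_of_ineq19_prop4 (P₀ : E →L[ℂ] E) (hP2 : ∀ x, P₀ (P₀ x) = P₀ x)
    (hPsa : ∀ x y, ⟪P₀ x, y⟫_ℂ = ⟪x, P₀ y⟫_ℂ) (H : E →L[ℂ] F) (Hst : F →L[ℂ] E)
    (hadj : ∀ (x : E) (y : F), ⟪H x, y⟫_ℂ = ⟪x, Hst y⟫_ℂ) (Δ₁ : F →L[ℂ] F) {c : ℝ} (hc : 0 < c)
    (hpos : ∀ x, P₀ x = x → c * ‖x‖ ^ 2 ≤ RCLike.re ⟪H x, Δ₁ (H x)⟫_ℂ) {dV : F → F} {C₄ a₃ : ℝ}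
    (hW : Prop4Hyp dV C₄ a₃) (hC₄ : 0 ≤ C₄) {h₁ hst ρ a r : ℝ} (hh₁ : 0 ≤ h₁) (hhst : 0 ≤ hst) (hρ0 : 0 < ρ)
    (ha : 0 < a) (hdom : 2 * (ρ + a) ≤ a₃) (hH : ∀ x : E, ‖H x‖ ≤ h₁ * ‖x‖)
    (hHst : ∀ z : F, ‖Hst z‖ ≤ hst * ‖z‖) (hρ : h₁ * (3 * r) ≤ ρ)
    (hsm1 : c⁻¹ * hst * (4 * C₄ * (ρ + a)) * h₁ ≤ 1 / 2) :
    ∃ Kinv : E →L[ℂ] E, ((∀ x, Kinv (P₀ (Hst (Δ₁ (H (P₀ x))))) = P₀ x) ∧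
        (∀ x, P₀ (Hst (Δ₁ (H (P₀ (Kinv x))))) = P₀ x) ∧ (∀ x, Kinv (P₀ x) = Kinv x) ∧
        (∀ x, P₀ (Kinv x) = Kinv x) ∧ ∀ x, ‖Kinv x‖ ≤ c⁻¹ * ‖P₀ x‖) ∧
      (∀ z : F, ‖Kinv (P₀ (Hst z))‖ ≤ c⁻¹ * hst * ‖z‖) ∧
      ∃ Bsol : F → E,
        (∀ J : F, ‖Kinv (P₀ (Hst J))‖ < r → AnalyticAt ℂ Bsol J) ∧
        ∀ J : F, ‖Kinv (P₀ (Hst J))‖ < r →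
          ‖Bsol J‖ ≤ 2 * ‖Kinv (P₀ (Hst J))‖ ∧
            Bsol J + Kinv (P₀ (Hst (dV (H (Bsol J))))) = -(Kinv (P₀ (Hst J))) := by
  have ha₃ : 0 < a₃ := by linarith
  have hρa₃ : ρ < a₃ := by linarith
  have hdV0 : dV 0 = 0 := dV_zero_of_prop4Hyp hW ha₃
  have hℓ : 0 ≤ 4 * C₄ * (ρ + a) := by positivity
  have hdV := lipschitz_of_prop4Hyp hW hC₄ ha hρ0.le hdom
  have hA : ∀ u : F, ‖u‖ < ρ → AnalyticAt ℂ dV u := fun u hu => analyticAt_of_prop4Hyp hW (hu.trans hρa₃)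
  exact B16Prop1IVInverseC.prop1IV_analytic_of_pos P₀ hP2 hPsa H Hst hadj Δ₁ hc hpos dV hh₁ hhst hℓ hρ0 hH hHst
    hdV0 hdV hA hρ hsm1

/-! ## §3. (1.40)/(1.41) p. 367 in the complex model from (1.9) and Proposition 4 [15] BY NAME -/

/-- **(1.40) p. 367 — *«exactly one solution B′_Λ(B̃′), which is an analytic function of the 𝔤ᶜ-valued small field
B̃′»* — from (1.9) and Proposition 4 [15] BY NAME**: `…B16Prop1IVInverseC.exists_analytic_solution140_of_pos` with
its three «Proposition 4 [15]» hypotheses discharged from `Prop4Hyp dV C₄ a₃` (§1; `ℓ = 4C₄(ρ' + a)` on the ball of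
radius `ρ'`, `2(ρ' + a) ≦ a₃`).  Conclusion: the inverse with the printed bound and a map `B̃′ ↦ B′_Λ(B̃′)`, `ℂ`-analytic
on `‖B̃′‖ < r`, solving (1.40) with `‖B′_Λ(B̃′)‖ ≦ 2c⁻¹hst·b‖B̃′‖`.
[cite: Balaban1989LargeFieldII, (1.40)–(1.41) p.367; p.359] [cite: Balaban1985Variational, Prop. 4 (97)-(98) pp.292-293] -/
theorem exists_analytic_solution140_of_ineq19_prop4 (P₀ : E →L[ℂ] E) (hP2 : ∀ x, P₀ (P₀ x) = P₀ x)
    (hPsa : ∀ x y, ⟪P₀ x, y⟫_ℂ = ⟪x, P₀ y⟫_ℂ) (H : E →L[ℂ] F) (Hst : F →L[ℂ] E)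
    (hadj : ∀ (x : E) (y : F), ⟪H x, y⟫_ℂ = ⟪x, Hst y⟫_ℂ) (Δ₁ : F →L[ℂ] F) {c : ℝ} (hc : 0 < c)
    (hpos : ∀ x, P₀ x = x → c * ‖x‖ ^ 2 ≤ RCLike.re ⟪H x, Δ₁ (H x)⟫_ℂ) {dV : F → F} {C₄ a₃ : ℝ}
    (hW : Prop4Hyp dV C₄ a₃) (hC₄ : 0 ≤ C₄) {h₁ hst b ρ a r : ℝ} (hh₁ : 0 ≤ h₁) (hhst : 0 ≤ hst)
    (hb : 0 ≤ b) (hρ0 : 0 < ρ) (ha : 0 < a) (hdom : 2 * (ρ + a) ≤ a₃)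
    (hH : ∀ x : E, ‖H x‖ ≤ h₁ * ‖x‖) (hHst : ∀ z : F, ‖Hst z‖ ≤ hst * ‖z‖)
    (hΔ : ∀ x : E, ‖Δ₁ (H x)‖ ≤ b * ‖x‖) (hρ : h₁ * ((2 * (c⁻¹ * hst) * b + 2) * r) ≤ ρ)
    (hsm1 : c⁻¹ * hst * (4 * C₄ * (ρ + a)) * h₁ ≤ 1 / 2)
    (hsm2 : 4 * C₄ * (ρ + a) * h₁ * (2 * (c⁻¹ * hst) * b + 1) ≤ b) :
    ∃ Kinv : E →L[ℂ] E, ((∀ x, Kinv (P₀ (Hst (Δ₁ (H (P₀ x))))) = P₀ x) ∧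
        (∀ x, P₀ (Hst (Δ₁ (H (P₀ (Kinv x))))) = P₀ x) ∧ (∀ x, Kinv (P₀ x) = Kinv x) ∧
        (∀ x, P₀ (Kinv x) = Kinv x) ∧ ∀ x, ‖Kinv x‖ ≤ c⁻¹ * ‖P₀ x‖) ∧
      ∃ sol : E → E, AnalyticOnNhd ℂ sol (ball (0 : E) r) ∧
        ∀ Bt : E, ‖Bt‖ < r → ‖sol Bt‖ ≤ 2 * (c⁻¹ * hst) * b * ‖Bt‖ ∧
          sol Bt + Kinv (P₀ (Hst (dV (H (sol Bt) + H Bt)))) = -(Kinv (P₀ (Hst (Δ₁ (H Bt))))) := by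
  have ha₃ : 0 < a₃ := by linarith
  have hρa₃ : ρ < a₃ := by linarith
  have hdV0 : dV 0 = 0 := dV_zero_of_prop4Hyp hW ha₃
  have hℓ : 0 ≤ 4 * C₄ * (ρ + a) := by positivity
  have hdV := lipschitz_of_prop4Hyp hW hC₄ ha hρ0.le hdom
  have hA : ∀ u : F, ‖u‖ < ρ → AnalyticAt ℂ dV u := fun u hu => analyticAt_of_prop4Hyp hW (hu.trans hρa₃)
  exact B16Prop1IVInverseC.exists_analytic_solution140_of_pos P₀ hP2 hPsa H Hst hadj Δ₁ hc hpos dV hh₁ hhst hb hℓ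
    hρ0 hH hHst hΔ hdV0 hdV hA hρ hsm1 hsm2

omit [CompleteSpace F] in
/-- **«Eq. (1.40) has exactly one solution B′_Λ(B̃′) … satisfying the bound (1.41)» p. 367, complex model, from (1.9)
and Proposition 4 [15] BY NAME**: `…B16Prop1IVInverseC.exactlyOne141_of_pos` with `dV 0 = 0` and the Lipschitz
constant `ℓ = 4C₄(ρ + a)` DISCHARGED from `Prop4Hyp dV C₄ a₃` (§1).  For every `‖B̃′‖ ≦ r`: a solution `B′` of (1.40)
satisfying **(1.41) AS TYPED** (`B16Sect1Statements.Ineq141 ‖B′‖ ‖B̃′‖ d M γ₀ B₃`) and `‖B′‖ ≦ 2c⁻¹hst·b‖B̃′‖`, any two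
solutions in the ball `‖B′‖ ≦ (2c⁻¹hst·b + 1)r` being equal; bookkeeping `c = γ₀/(2d(100M)⁵)` ((1.9)) and
`hst·b ≦ B₃²`. [cite: Balaban1989LargeFieldII, (1.40)–(1.41) p.367; p.359; (1.9) p.358]
[cite: Balaban1985Variational, Prop. 4 (97)-(98) pp.292-293; (119)-(120) p.295] -/
theorem exactlyOne141_of_ineq19_prop4 (P₀ : E →L[ℂ] E) (hP2 : ∀ x, P₀ (P₀ x) = P₀ x)
    (hPsa : ∀ x y, ⟪P₀ x, y⟫_ℂ = ⟪x, P₀ y⟫_ℂ) (H : E →L[ℂ] F) (Hst : F →L[ℂ] E)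
    (hadj : ∀ (x : E) (y : F), ⟪H x, y⟫_ℂ = ⟪x, Hst y⟫_ℂ) (Δ₁ : F →L[ℂ] F) {c γ₀ M B₃ : ℝ} {d : ℕ}
    (hc : 0 < c) (hcdef : c = γ₀ / (2 * d * (100 * M) ^ 5))
    (hpos : ∀ x, P₀ x = x → c * ‖x‖ ^ 2 ≤ RCLike.re ⟪H x, Δ₁ (H x)⟫_ℂ) {dV : F → F} {C₄ a₃ : ℝ}
    (hW : Prop4Hyp dV C₄ a₃) (hC₄ : 0 ≤ C₄) {h₁ hst b ρ a r : ℝ} (hh₁ : 0 ≤ h₁) (hhst : 0 ≤ hst)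
    (hb : 0 ≤ b) (hρ0 : 0 ≤ ρ) (ha : 0 < a) (hdom : 2 * (ρ + a) ≤ a₃)
    (hH : ∀ x : E, ‖H x‖ ≤ h₁ * ‖x‖) (hHst : ∀ z : F, ‖Hst z‖ ≤ hst * ‖z‖)
    (hΔ : ∀ x : E, ‖Δ₁ (H x)‖ ≤ b * ‖x‖) (hB : hst * b ≤ B₃ ^ 2)
    (hρ : h₁ * ((2 * (c⁻¹ * hst) * b + 2) * r) ≤ ρ)
    (hsm1 : c⁻¹ * hst * (4 * C₄ * (ρ + a)) * h₁ ≤ 1 / 2)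
    (hsm2 : 4 * C₄ * (ρ + a) * h₁ * (2 * (c⁻¹ * hst) * b + 1) ≤ b) {Bt : E} (hBt : ‖Bt‖ ≤ r) :
    ∃ Kinv : E →L[ℂ] E, ((∀ x, Kinv (P₀ (Hst (Δ₁ (H (P₀ x))))) = P₀ x) ∧
        (∀ x, P₀ (Hst (Δ₁ (H (P₀ (Kinv x))))) = P₀ x) ∧ (∀ x, Kinv (P₀ x) = Kinv x) ∧
        (∀ x, P₀ (Kinv x) = Kinv x) ∧ ∀ x, ‖Kinv x‖ ≤ c⁻¹ * ‖P₀ x‖) ∧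
      (∃ x : E, B16Sect1Statements.Ineq141 ‖x‖ ‖Bt‖ d M γ₀ B₃ ∧ ‖x‖ ≤ 2 * (c⁻¹ * hst) * b * ‖Bt‖ ∧
          x + Kinv (P₀ (Hst (dV (H x + H Bt)))) = -(Kinv (P₀ (Hst (Δ₁ (H Bt)))))) ∧
        ∀ x y : E, ‖x‖ ≤ (2 * (c⁻¹ * hst) * b + 1) * r → ‖y‖ ≤ (2 * (c⁻¹ * hst) * b + 1) * r →
          x + Kinv (P₀ (Hst (dV (H x + H Bt)))) = -(Kinv (P₀ (Hst (Δ₁ (H Bt))))) →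
          y + Kinv (P₀ (Hst (dV (H y + H Bt)))) = -(Kinv (P₀ (Hst (Δ₁ (H Bt))))) → x = y := by
  have ha₃ : 0 < a₃ := by linarith
  have hdV0 : dV 0 = 0 := dV_zero_of_prop4Hyp hW ha₃
  have hℓ : 0 ≤ 4 * C₄ * (ρ + a) := by positivity
  have hdV := lipschitz_of_prop4Hyp hW hC₄ ha hρ0 hdom
  exact B16Prop1IVInverseC.exactlyOne141_of_pos P₀ hP2 hPsa H Hst hadj Δ₁ hc hcdef hpos dV hh₁ hhst hb hℓ hH hHst
    hΔ hB hdV0 hdV hρ hsm1 hsm2 hBt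

end Assembly

/-! ## §4 (v1.1, r13 gen 17, append-only). The criticality equation (1.12) itself for 𝔤ᶜ-valued fields — `RCLike` twin of `…B16Eq112` — and Proposition 1 [IV] in the complex model IN ITS PRINTED (1.12) FORM

p. 359: *«Now the condition for a critical configuration is the equation ⟨δB′, H*_{1,k}J_{k,Z}⟩ + ⟨δB′, H*_{1,k}Δ₁H_{1,k}B′⟩
+ ⟨δB′, H*_{1,k}((δ/δA)V)(H_{1,k}B′)⟩ = 0. (1.12) … Equation (1.12) can be written as (1.13) … The above equations,
bounds and statements are valid for 𝔤ᶜ-valued fields»*.  `…B16Eq112` (r13 gen 3) proves (1.12) ⇔ (1.13) over `ℝ`;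
§§2–3 above and `…B16Prop1IVAnalytic` conclude the fixed-point form (1.13).  Here: the equivalence over any `RCLike`
field for bounded operators (`forall_gauge_inner_eq_zero_iff`, `eq112_iff_proj_eq_zero`, `eq112_iff_eq113` — the
gen-3 proofs verbatim with `𝕜` for `ℝ`), and the capstone **`prop1IV_complex`**: from (1.9) (`hpos`) and Proposition
4 [15] (`Prop4Hyp`) BY NAME, for every current `J` in the ball `‖Kinv P₀ H* J‖ < r` there is a configuration `B′(J)`
IN THE GAUGE SUBSPACE, `ℂ`-analytic in `J`, with `‖B′(J)‖ ≦ 2‖Kinv P₀ H* J‖`, satisfying the CRITICALITY EQUATION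
(1.12) for all gauge variations, and UNIQUE among gauge-subspace configurations of norm `≦ 3r` satisfying (1.12) —
existence, uniqueness, bound (1.78)[IV]-shape and analytic extension of Proposition 1 [IV], complex model. -/

section Eq112C

variable {𝕜 : Type*} [RCLike 𝕜] {E F : Type*} [NormedAddCommGroup E] [InnerProductSpace 𝕜 E]
  [NormedAddCommGroup F] [InnerProductSpace 𝕜 F]

/-- In the gauge subspace `P₀E` (`P₀` idempotent symmetric), `RCLike` scalars: `⟨δB′, X⟩ = 0` for all gauge
variations `δB′ = P₀δB′` iff `P₀X = 0` (twin of `B16Eq112.forall_gauge_inner_eq_zero_iff`).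
[cite: Balaban1989LargeFieldII, (1.12) p.359] -/
theorem forall_gauge_inner_eq_zero_iff (P₀ : E →L[𝕜] E) (hP2 : ∀ x, P₀ (P₀ x) = P₀ x)
    (hPsa : ∀ x y, ⟪P₀ x, y⟫_𝕜 = ⟪x, P₀ y⟫_𝕜) (X : E) :
    (∀ δB : E, P₀ δB = δB → ⟪δB, X⟫_𝕜 = 0) ↔ P₀ X = 0 := by
  constructor
  · intro h
    refine ext_inner_left 𝕜 fun w => ?_
    rw [inner_zero_right, ← hPsa]
    exact h (P₀ w) (hP2 w)
  · intro h δB hδ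
    rw [← hδ, hPsa, h, inner_zero_right]

/-- **(1.12) in operator form**, `RCLike` scalars (𝔤ᶜ-valued fields): for `B′` and all variations in the gauge,
(1.12) holds iff `P₀(H*J + H*Δ₁HB′ + H*((δ/δA)V)(HB′)) = 0` (twin of `B16Eq112.eq112_iff_proj_eq_zero`).
[cite: Balaban1989LargeFieldII, (1.12) p.359] -/
theorem eq112_iff_proj_eq_zero (P₀ : E →L[𝕜] E) (hP2 : ∀ x, P₀ (P₀ x) = P₀ x)
    (hPsa : ∀ x y, ⟪P₀ x, y⟫_𝕜 = ⟪x, P₀ y⟫_𝕜) (H : E →L[𝕜] F) (Hst : F →L[𝕜] E) (Δ₁ : F →L[𝕜] F) (dV : F → F)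
    (J : F) (B : E) :
    (∀ δB : E, P₀ δB = δB → ⟪δB, Hst J⟫_𝕜 + ⟪δB, Hst (Δ₁ (H B))⟫_𝕜 + ⟪δB, Hst (dV (H B))⟫_𝕜 = 0) ↔
      P₀ (Hst J + Hst (Δ₁ (H B)) + Hst (dV (H B))) = 0 := by
  rw [← forall_gauge_inner_eq_zero_iff P₀ hP2 hPsa]
  refine forall₂_congr fun δB _ => ?_
  rw [inner_add_right, inner_add_right]

/-- **(1.12) ⇔ (1.13) for 𝔤ᶜ-valued fields** (*«Equation (1.12) can be written as (1.13) … valid for 𝔤ᶜ-valued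
fields»*, p. 359), `RCLike` scalars, bounded operators: for `B′` in the gauge subspace and `Kinv` the inverse of
`K = P₀H*Δ₁HP₀` there (`KinvK = P₀`, `KKinv = P₀`, `Kinv = KinvP₀` — e.g. the `Kinv` of
`B16Prop1IVInverseC.exists_inverse_of_pos`), the variational equation (1.12) is EQUIVALENT to the fixed-point equation
(1.13) (twin of `B16Eq112.eq112_iff_eq113`, same proof). [cite: Balaban1989LargeFieldII, (1.12)–(1.13) p.359] -/
theorem eq112_iff_eq113 (P₀ : E →L[𝕜] E) (hP2 : ∀ x, P₀ (P₀ x) = P₀ x)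
    (hPsa : ∀ x y, ⟪P₀ x, y⟫_𝕜 = ⟪x, P₀ y⟫_𝕜) (H : E →L[𝕜] F) (Hst : F →L[𝕜] E) (Δ₁ : F →L[𝕜] F) (dV : F → F)
    (J : F) {Kinv : E →L[𝕜] E} (hKl : ∀ x, Kinv (P₀ (Hst (Δ₁ (H (P₀ x))))) = P₀ x)
    (hKr : ∀ x, P₀ (Hst (Δ₁ (H (P₀ (Kinv x))))) = P₀ x) (hKP : ∀ x, Kinv (P₀ x) = Kinv x) {B : E}
    (hB : P₀ B = B) :
    (∀ δB : E, P₀ δB = δB → ⟪δB, Hst J⟫_𝕜 + ⟪δB, Hst (Δ₁ (H B))⟫_𝕜 + ⟪δB, Hst (dV (H B))⟫_𝕜 = 0) ↔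
      B + Kinv (P₀ (Hst (dV (H B)))) = -(Kinv (P₀ (Hst J))) := by
  rw [eq112_iff_proj_eq_zero P₀ hP2 hPsa]
  have hKB : Kinv (P₀ (Hst (Δ₁ (H B)))) = B := by
    have h := hKl B
    rwa [hB] at h
  constructor
  · intro h
    have h' := congrArg Kinv h
    rw [map_zero, map_add P₀, map_add P₀, map_add Kinv, map_add Kinv, hKB] at h'
    rw [eq_neg_iff_add_eq_zero, ← h']
    abel
  · intro h
    have hKr' : ∀ x, P₀ (Hst (Δ₁ (H (P₀ (Kinv (P₀ x)))))) = P₀ x := fun x => by rw [hKP, hKr]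
    have h' := congrArg (fun y => P₀ (Hst (Δ₁ (H (P₀ y))))) h
    simp only [map_add, map_neg, hKr', hB] at h'
    rw [map_add, map_add, add_assoc, h', add_neg_cancel]

end Eq112C

section Capstone

variable {E F : Type*} [NormedAddCommGroup E] [InnerProductSpace ℂ E] [FiniteDimensional ℂ E]
  [NormedAddCommGroup F] [InnerProductSpace ℂ F] [CompleteSpace F]

/-- **Proposition 1 [IV] as proved on p. 359 — complex model, printed (1.12) form, from (1.9) and Proposition 4 [15]
BY NAME.**  Data: `P₀` idempotent symmetric (the gauge projection), `H = H_{1,k}`, `H* = Hst` its adjoint,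
`Δ₁ = Δ₁(ζ₀)`, `dV = (δ/δA)V`; hypotheses: the (1.9) positivity `c‖B′‖² ≦ re ⟨HB′, Δ₁HB′⟩` on the gauge subspace
(`c = γ₀/(2d(100M)⁵)`), r08's `B11Prop6Scheme.Prop4Hyp dV C₄ a₃` ([15] Prop. 4), `‖H‖ ≦ h₁`, `‖H*‖ ≦ hst`, radii
`ρ, a > 0` with `2(ρ + a) ≦ a₃`, the room `h₁·3r ≦ ρ` and the smallness `c⁻¹hst·4C₄(ρ + a)·h₁ ≦ ½`.  Conclusion: the
inverse `Kinv` of `P₀H*Δ₁HP₀` on the gauge subspace with `‖Kinv x‖ ≦ c⁻¹‖P₀x‖` (*«bounded by γ₀⁻¹2d(100M)⁵»*), and a map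
`J ↦ B′(J)` such that for every current with `‖Kinv P₀ H* J‖ < r`: `B′(J)` is `ℂ`-ANALYTIC at `J` (*«the existence of
the analytic extension follows immediately»*), lies in the gauge subspace, obeys `‖B′(J)‖ ≦ 2‖Kinv P₀ H* J‖` (*«a bound
equal to twice a bound of the right-hand side»*, the (1.78)[IV] shape), satisfies the CRITICALITY EQUATION (1.12) for
all gauge variations `δB′`, and is the ONLY gauge-subspace configuration of norm `≦ 3r` doing so (*«exactly one
solution»*). [cite: Balaban1989LargeFieldII, p.359 (proof of Proposition 1 [IV]), (1.12)–(1.13), (1.9) p.358]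
[cite: Balaban1985Variational, Prop. 4 (97)-(98) pp.292-293] [cite: Balaban1989LargeFieldI, Proposition 1 p.194] -/
theorem prop1IV_complex (P₀ : E →L[ℂ] E) (hP2 : ∀ x, P₀ (P₀ x) = P₀ x)
    (hPsa : ∀ x y, ⟪P₀ x, y⟫_ℂ = ⟪x, P₀ y⟫_ℂ) (H : E →L[ℂ] F) (Hst : F →L[ℂ] E)
    (hadj : ∀ (x : E) (y : F), ⟪H x, y⟫_ℂ = ⟪x, Hst y⟫_ℂ) (Δ₁ : F →L[ℂ] F) {c : ℝ} (hc : 0 < c)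
    (hpos : ∀ x, P₀ x = x → c * ‖x‖ ^ 2 ≤ RCLike.re ⟪H x, Δ₁ (H x)⟫_ℂ) {dV : F → F} {C₄ a₃ : ℝ}
    (hW : Prop4Hyp dV C₄ a₃) (hC₄ : 0 ≤ C₄) {h₁ hst ρ a r : ℝ} (hh₁ : 0 ≤ h₁) (hhst : 0 ≤ hst) (hρ0 : 0 < ρ)
    (ha : 0 < a) (hdom : 2 * (ρ + a) ≤ a₃) (hH : ∀ x : E, ‖H x‖ ≤ h₁ * ‖x‖)
    (hHst : ∀ z : F, ‖Hst z‖ ≤ hst * ‖z‖) (hρ : h₁ * (3 * r) ≤ ρ)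
    (hsm1 : c⁻¹ * hst * (4 * C₄ * (ρ + a)) * h₁ ≤ 1 / 2) :
    ∃ Kinv : E →L[ℂ] E, ((∀ x, Kinv (P₀ (Hst (Δ₁ (H (P₀ x))))) = P₀ x) ∧
        (∀ x, P₀ (Hst (Δ₁ (H (P₀ (Kinv x))))) = P₀ x) ∧ (∀ x, Kinv (P₀ x) = Kinv x) ∧
        (∀ x, P₀ (Kinv x) = Kinv x) ∧ ∀ x, ‖Kinv x‖ ≤ c⁻¹ * ‖P₀ x‖) ∧
      (∀ z : F, ‖Kinv (P₀ (Hst z))‖ ≤ c⁻¹ * hst * ‖z‖) ∧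
      ∃ Bsol : F → E, ∀ J : F, ‖Kinv (P₀ (Hst J))‖ < r →
        AnalyticAt ℂ Bsol J ∧ P₀ (Bsol J) = Bsol J ∧ ‖Bsol J‖ ≤ 2 * ‖Kinv (P₀ (Hst J))‖ ∧
          (∀ δB : E, P₀ δB = δB →
            ⟪δB, Hst J⟫_ℂ + ⟪δB, Hst (Δ₁ (H (Bsol J)))⟫_ℂ + ⟪δB, Hst (dV (H (Bsol J)))⟫_ℂ = 0) ∧
          ∀ B' : E, P₀ B' = B' → ‖B'‖ ≤ 3 * r →
            (∀ δB : E, P₀ δB = δB →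
              ⟪δB, Hst J⟫_ℂ + ⟪δB, Hst (Δ₁ (H B'))⟫_ℂ + ⟪δB, Hst (dV (H B'))⟫_ℂ = 0) → B' = Bsol J := by
  haveI : CompleteSpace E := FiniteDimensional.complete ℂ E
  have ha₃ : 0 < a₃ := by linarith
  have hρa₃ : ρ < a₃ := by linarith
  have hdV0 : dV 0 = 0 := dV_zero_of_prop4Hyp hW ha₃
  have hℓ : 0 ≤ 4 * C₄ * (ρ + a) := by positivity
  have hdV := lipschitz_of_prop4Hyp hW hC₄ ha hρ0.le hdom
  have hA : ∀ u : F, ‖u‖ < ρ → AnalyticAt ℂ dV u := fun u hu => analyticAt_of_prop4Hyp hW (hu.trans hρa₃)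
  obtain ⟨Kinv, hKl, hKr, hKP, hPK, hbd⟩ :=
    B16Prop1IVInverseC.exists_inverse_of_pos P₀ hP2 hPsa H Hst hadj Δ₁ hc hpos
  have hKop : ∀ z : F, ‖Kinv (P₀ (Hst z))‖ ≤ c⁻¹ * hst * ‖z‖ :=
    B16Prop1IVInverseC.kinv_comp_bound P₀ hP2 hPsa Hst Kinv hc hbd hHst
  have hκ₁ : 0 ≤ c⁻¹ * hst := mul_nonneg (inv_nonneg.mpr hc.le) hhst
  obtain ⟨Bsol, hBa, hB⟩ :=
    B16Prop1IVAnalytic.prop1IV_analytic_in_J P₀ Kinv H Hst dV hκ₁ hh₁ hℓ hρ0 hKop hH hdV0 hdV hA hρ hsm1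
  refine ⟨Kinv, ⟨hKl, hKr, hKP, hPK, hbd⟩, hKop, Bsol, fun J hJ => ?_⟩
  obtain ⟨hBn, hBe⟩ := hB J hJ
  -- the solution lies in the gauge subspace: B′ = −Kinv(…) − Kinv(…) is in the range of Kinv
  have hBg : P₀ (Bsol J) = Bsol J := by
    have e : Bsol J = -(Kinv (P₀ (Hst J))) - Kinv (P₀ (Hst (dV (H (Bsol J))))) := by
      rw [← hBe]; abel
    rw [e, map_sub, map_neg, hPK, hPK]
  refine ⟨hBa J hJ, hBg, hBn, ?_, ?_⟩
  · exact (eq112_iff_eq113 P₀ hP2 hPsa H Hst Δ₁ dV J hKl hKr hKP hBg).mpr hBe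
  · intro B' hB'g hB'n h112
    have h113 : B' + Kinv (P₀ (Hst (dV (H B')))) = -(Kinv (P₀ (Hst J))) :=
      (eq112_iff_eq113 P₀ hP2 hPsa H Hst Δ₁ dV J hKl hKr hKP hB'g).mp h112
    have hr : 0 ≤ r := (norm_nonneg _).trans hJ.le
    have hBn' : ‖Bsol J‖ ≤ 3 * r := by linarith
    exact B16Prop1IVAnalytic.solution113_unique P₀ Kinv H Hst dV hκ₁ hh₁ hℓ hKop hH hdV hρ hsm1 hB'n hBn'
      h113 hBe

end Capstone

end Literature.MathematicalPhysics.QuantumFieldTheory.Balaban1983to89.B16Prop1IVFromProp4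

end
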